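/-
Copyright (c) 2026 the pub-hodgecm-mathlib formalisation cell (harness21).  Prover seat hodgecm-mathlib-K2E1-p10 (g2), Track B ∕ K2-LIT (build stream 29), h413 = `stmt-HodgeConjecture-24833`,
route of record `HCCMUnconditional`, ROADCARD «5Res ENDGAME BY FAMILIES» §2 C7; dealer K2E1-plan (g7) deals (217)∕(232) — FILE F3d-β of the C7 split: a `χ`-ISOTYPIC NICE FUNCTION ON
`N(𝔸)B(F)∖G(𝔸)∕K′` IS A FINITE SUM OF PURE TENSORS `f(H)·φ`, `φ ∈ chiSectionSpace χ K′ 1`.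
-/
import Summits.HodgeConjecture.HodgeConjecture.Theorems.K2E1ChiSectionSpaceU2Defs     -- ★ DEFS: `chiSectionSpace χ K′ ω`, `firstEntryUnit_eq_diagUnit_zero` (+ ★ `K2E1CharacterEisensteinU2Defs`: `IsChiSection`, `firstEntryUnit`)
import Summits.HodgeConjecture.HodgeConjecture.Theorems.K2E1ChiSectionBridgeU2         -- ★ (K2E4-p10): `borelHeight_borel_mul_eq_ideleNorm_firstEntryUnit_mul` (`H(b g) = ‖b₀₀‖ H(g)`)
import Literature.NumberTheory.Automorphic.UnitaryGroupTorusRayTwo                   -- ★ `exists_torusRay_two` (the continuous diagonal ray `ρ`, `d₀(ρ s) = z_E(e^s)`)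
import Literature.NumberTheory.Automorphic.UnitaryGroupBorelThinSetIntegralEq        -- ★ `diagUnit_mul`
import Literature.NumberTheory.Automorphic.UnitaryGroupBorelSiegelSetThin            -- ★ `diagUnit_inv_apply`
import Literature.NumberTheory.Automorphic.UnitaryGroupTorusSiegelCoordinates        -- ★ `ideleNorm_posRealIdele_expUnitNNReal`
import Mathlib.GroupTheory.DoubleCoset
import HarnessLib

/-!
# h413 ∕ Track B «K2-LIT», ROADCARD «5Res BY FAMILIES» C7, FILE F3d-β — helper `K2E1ChiIsotypicPureTensorDecompositionU2`: a right-`K′`-invariant `ψ` on `U(J₂)(𝔸_F)` that is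
# `χ`-ISOTYPIC under the norm-one Borel (`ψ(b g) = χ(b₀₀) ψ(g)` whenever `‖b₀₀‖ = 1`), with `χ` trivial on the real ray, continuous and supported in a height band, IS A FINITE SUM
# `ψ = Σ_q f_q(H)·φ_q` OF PURE TENSORS with `f_q ∈ C_c((0,∞))` and `φ_q ∈ chiSectionSpace χ K′ 1` continuous — one term per `(B(𝔸), K′)`-double coset

Cell `pub/hodgecm-mathlib`, crux h413 = `stmt-HodgeConjecture-24833`, route of record `HCCMUnconditional`; dealer K2E1-plan (g7) (232).  THEOREMS ONLY (no `def`, no `instance`, no notation, no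
named-fact hypothesis, no `sorry`); lane `--supports stmt-HodgeConjecture-24833 --as helper` (count-neutral).  Closes no socket.  Generic quadratic datum `(F, E, c)` with `c² = 1`, `U(J₂)`;
`K′` an OPEN subgroup of `G(𝔸)` on which the Borel height is right-invariant (`hHK′`, e.g. `K′ ≤ K_max`) with FINITELY MANY `(B(𝔸), K′)`-double cosets (`hBK`, hypothesis-first as in ★
`forall_exists_borel_mul_out_mul_of_iwasawa`); `χ : HeckeCharacter E` with `χ(z_E(r)) = 1` on the positive real ray (`hχray`).

THE MATHEMATICS ([MoeglinWaldspurger1995, I.2.17, II.1.1]; [GelbartJacquet1979Corvallis, §3]; [Garrett2018, §2.2]).  On a double coset `d = B(𝔸) w K′` write `g = β w k`.  (i) The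
STABILISER `B_w = {β ∈ B(𝔸) : β w ∈ w K′}` consists of norm-one elements (`H(βw) = ‖β₀₀‖H(w)` and `H` is right-`K′`-invariant), so if `ψ ≢ 0` on `d` then `χ(β₀₀) = 1` on `B_w`
(`ψ(β₀βw) = ψ(β₀w)` by right invariance and `= χ(β₀₀)ψ(β₀w)` by isotypy applied to `β₀ββ₀⁻¹`): hence `φ_d(βwk) := χ(β₀₀)` is WELL DEFINED, a `χ`-section (`φ_d(b g) = χ(b₀₀)φ_d(g)`),
right-`K′`-invariant, zero off `d`, and continuous (locally constant, `K′` open).  (ii) With the continuous diagonal ray `ρ` of ★ `exists_torusRay_two` (`d₀(ρ s) = z_E(e^s)`,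
`‖z_E(e^s)‖ = e^{[E:ℚ]s}`) put `f_d(h) := ψ(ρ(s_h) w)`, `s_h = log(h∕H(w))∕[E:ℚ]` for `h > 0` (else `0`): continuous, supported in the band `[a, b] ⊂ (0,∞)` of `ψ`.  (iii) For `g = βwk`:
`β = β₁ρ(s)` with `‖(β₁)₀₀‖ = 1`, `e^{[E:ℚ]s} = ‖β₀₀‖ = H(g)∕H(w)`, so `ψ(g) = ψ(β₁ρ(s)w) = χ((β₁)₀₀)ψ(ρ(s)w) = χ(β₀₀)·f_d(H(g)) = φ_d(g) f_d(H(g))` (`χ(d₀ρ(s)) = 1`).  Summing over the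
finitely many double cosets (Mathlib `DoubleCoset.Quotient`, one representative each) gives `ψ = Σ_d f_d(H)·φ_d`.

* §1 `continuous_of_mul_mem_isOpen` (right-`K′`-invariant ⇒ continuous), `ideleNorm_firstEntryUnit_eq_one_of_mul_eq` (stabilisers are norm-one), `chi_firstEntryUnit_eq_one_of_apply_ne_zero`
  (the dichotomy), `chi_firstEntryUnit_eq_of_eq` (well-definedness).
* §2 **`exists_pureTensor_on_doubleCoset`** (one double coset).  §3 **`exists_sum_pureTensor_eq`** (the decomposition; index type `ι` finite).

HONEST LABEL: HC_CM is proved only modulo the 7 printed citations (2 remaining named inputs: hLiu418 = `stmt-HodgeConjecture-24832`, h413 = `stmt-HodgeConjecture-24833`) until rung 0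
closes; this file asserts no named fact and closes no socket.
References: [MoeglinWaldspurger1995] C. Mœglin, J.-L. Waldspurger, *Spectral Decomposition and Eisenstein Series*, I.2.17, II.1.1; [GelbartJacquet1979Corvallis] S. Gelbart, H. Jacquet,
*Forms of GL(2) from the analytic point of view*, §3; [Garrett2018] P. Garrett, *Modern Analysis of Automorphic Forms by Example*, §2.2; [Rogawski1990] J. Rogawski, *Automorphic
Representations of Unitary Groups in Three Variables*, §1.10, §2.2.
-/

set_option autoImplicit false
set_option linter.dupNamespace false  -- the mandated namespace repeats the summit's segment (`HodgeConjecture.HodgeConjecture`)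

noncomputable section

open MeasureTheory Set Filter Topology NumberField
open Literature.NumberTheory.Automorphic Literature.NumberTheory.Automorphic.UnitaryGroup Literature.NumberTheory.GaloisRepresentations
open Summit.HodgeConjecture.HodgeConjecture.Cruxes.H413.K2E1CharacterEisensteinU2Defs
open Summit.HodgeConjecture.HodgeConjecture.Cruxes.H413.K2E1ChiSectionSpaceU2Defs
open Summit.HodgeConjecture.HodgeConjecture.Cruxes.H413.K2E1ChiSectionBridgeU2 (borelHeight_borel_mul_eq_ideleNorm_firstEntryUnit_mul)
open scoped NNReal

namespace Summit.HodgeConjecture.HodgeConjecture.Cruxes.H413.K2E1ChiIsotypicPureTensorDecompositionU2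

variable {F E : Type} [Field F] [NumberField F] [Field E] [NumberField E] [Algebra F E] {c : E ≃ₐ[F] E}

/-! ## §1 Stabilisers are norm-one; the dichotomy; well-definedness -/

/-- **A RIGHT-`K′`-INVARIANT FUNCTION IS CONTINUOUS WHEN `K′` IS OPEN** (it is constant on the open sets `g K′`). [folklore] -/
theorem continuous_of_mul_mem_isOpen {M : Type*} [TopologicalSpace M] {K' : Subgroup (quasiSplit F E c 2).Adelic} (hK'o : IsOpen (K' : Set (quasiSplit F E c 2).Adelic))
    {φ : (quasiSplit F E c 2).Adelic → M} (hφ : ∀ (g k : (quasiSplit F E c 2).Adelic), k ∈ K' → φ (g * k) = φ g) : Continuous φ := by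
  refine continuous_iff_continuousAt.2 fun g => ?_
  have hU : IsOpen ((fun k => g * k) '' (K' : Set (quasiSplit F E c 2).Adelic)) := (Homeomorph.mulLeft g).isOpenMap _ hK'o
  have hmem : g ∈ (fun k => g * k) '' (K' : Set (quasiSplit F E c 2).Adelic) := ⟨1, K'.one_mem, mul_one g⟩
  refine (continuousAt_const (y := φ g)).congr (Filter.eventuallyEq_of_mem (hU.mem_nhds hmem) ?_)
  rintro _ ⟨k, hk, rfl⟩
  exact (hφ g k hk).symm

/-- **STABILISERS ARE NORM-ONE**: if `β ∈ B(𝔸)` and `β w = w k` with `k ∈ K′` (`H` right-`K′`-invariant) then `‖β₀₀‖ = 1` (`H(βw) = ‖β₀₀‖·H(w) = H(wk) = H(w) > 0`). [cite: Garrett2018, §2.2] -/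
theorem ideleNorm_firstEntryUnit_eq_one_of_mul_eq {K' : Subgroup (quasiSplit F E c 2).Adelic}
    (hHK' : ∀ (g k : (quasiSplit F E c 2).Adelic), k ∈ K' → borelHeight (g * k) = borelHeight g)
    {β : (quasiSplit F E c 2).Adelic} (hβ : β ∈ borelAdelic F E c 2) {w k : (quasiSplit F E c 2).Adelic} (hk : k ∈ K') (h : β * w = w * k) :
    IdeleClassGroup.ideleNorm E (firstEntryUnit hβ) = 1 := by
  have h1 := borelHeight_borel_mul_eq_ideleNorm_firstEntryUnit_mul hβ w
  rw [h, hHK' w k hk] at h1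
  have hw : borelHeight w ≠ 0 := (borelHeight_pos w).ne'
  exact (mul_eq_right₀ hw).1 h1.symm

/-- `d₀(β₀ β β₀⁻¹) = d₀ β` on `B(𝔸)` (the diagonal is multiplicative, ★ `diagUnit_mul`, and `𝕀_E` is commutative). [cite: Rogawski1990, §1.10] -/
theorem firstEntryUnit_conj {β₀ β : (quasiSplit F E c 2).Adelic} (hβ₀ : β₀ ∈ borelAdelic F E c 2) (hβ : β ∈ borelAdelic F E c 2) :
    firstEntryUnit ((borelAdelic F E c 2).mul_mem ((borelAdelic F E c 2).mul_mem hβ₀ hβ) ((borelAdelic F E c 2).inv_mem hβ₀)) = firstEntryUnit hβ := by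
  rw [firstEntryUnit_eq_diagUnit_zero, firstEntryUnit_eq_diagUnit_zero]
  have h := congr_fun (diagUnit_mul (⟨β₀, hβ₀⟩ * ⟨β, hβ⟩ : borelAdelic F E c 2) (⟨β₀, hβ₀⟩⁻¹)) 0
  have h' := congr_fun (diagUnit_mul (⟨β₀, hβ₀⟩ : borelAdelic F E c 2) ⟨β, hβ⟩) 0
  simp only [Pi.mul_apply, diagUnit_inv_apply] at h h'
  calc diagUnit _ 0 = diagUnit ((⟨β₀, hβ₀⟩ * ⟨β, hβ⟩ : borelAdelic F E c 2) * (⟨β₀, hβ₀⟩ : borelAdelic F E c 2)⁻¹).2 0 := rfl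
    _ = diagUnit ((⟨β₀, hβ₀⟩ * ⟨β, hβ⟩ : borelAdelic F E c 2)).2 0 * (diagUnit hβ₀ 0)⁻¹ := h
    _ = diagUnit hβ₀ 0 * diagUnit hβ 0 * (diagUnit hβ₀ 0)⁻¹ := by rw [h']
    _ = diagUnit hβ 0 := by rw [mul_comm (diagUnit hβ₀ 0), mul_assoc, mul_inv_cancel, mul_one]

/-- `d₀(β⁻¹ β') = (d₀ β)⁻¹ d₀ β'`. [cite: Rogawski1990, §1.10] -/
theorem firstEntryUnit_inv_mul {β β' : (quasiSplit F E c 2).Adelic} (hβ : β ∈ borelAdelic F E c 2) (hβ' : β' ∈ borelAdelic F E c 2) :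
    firstEntryUnit ((borelAdelic F E c 2).mul_mem ((borelAdelic F E c 2).inv_mem hβ) hβ') = (firstEntryUnit hβ)⁻¹ * firstEntryUnit hβ' := by
  rw [firstEntryUnit_eq_diagUnit_zero, firstEntryUnit_eq_diagUnit_zero, firstEntryUnit_eq_diagUnit_zero]
  have h := congr_fun (diagUnit_mul ((⟨β, hβ⟩ : borelAdelic F E c 2)⁻¹) ⟨β', hβ'⟩) 0
  simp only [Pi.mul_apply, diagUnit_inv_apply] at h
  exact h

/-- `d₀(b β) = d₀ b · d₀ β`. [cite: Rogawski1990, §1.10] -/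
theorem firstEntryUnit_mul {b β : (quasiSplit F E c 2).Adelic} (hb : b ∈ borelAdelic F E c 2) (hβ : β ∈ borelAdelic F E c 2) :
    firstEntryUnit ((borelAdelic F E c 2).mul_mem hb hβ) = firstEntryUnit hb * firstEntryUnit hβ := by
  rw [firstEntryUnit_eq_diagUnit_zero, firstEntryUnit_eq_diagUnit_zero, firstEntryUnit_eq_diagUnit_zero]
  exact congr_fun (diagUnit_mul (⟨b, hb⟩ : borelAdelic F E c 2) ⟨β, hβ⟩) 0

/-- **THE DICHOTOMY**: if `ψ` is right-`K′`-invariant and `χ`-isotypic under the norm-one Borel, and `ψ(β₀ w) ≠ 0` for some `β₀ ∈ B(𝔸)`, then **`χ(β₀₀) = 1` for every `β` in the stabiliser**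
`B_w = {β ∈ B(𝔸) : β w ∈ w K′}` (`ψ(β₀βw) = ψ(β₀w)` by right invariance, `= χ(β₀₀)ψ(β₀w)` by isotypy at `β₀ββ₀⁻¹`). [cite: MoeglinWaldspurger1995, I.2.17] -/
theorem chi_firstEntryUnit_eq_one_of_apply_ne_zero {K' : Subgroup (quasiSplit F E c 2).Adelic}
    (hHK' : ∀ (g k : (quasiSplit F E c 2).Adelic), k ∈ K' → borelHeight (g * k) = borelHeight g) (χ : HeckeCharacter E)
    {ψ : (quasiSplit F E c 2).Adelic → ℂ} (hψK : ∀ (g k : (quasiSplit F E c 2).Adelic), k ∈ K' → ψ (g * k) = ψ g)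
    (hψχ : ∀ (b : (quasiSplit F E c 2).Adelic) (hb : b ∈ borelAdelic F E c 2), IdeleClassGroup.ideleNorm E (firstEntryUnit hb) = 1 →
      ∀ g, ψ (b * g) = ((χ (firstEntryUnit hb) : ℂˣ) : ℂ) * ψ g)
    {w β₀ : (quasiSplit F E c 2).Adelic} (hβ₀ : β₀ ∈ borelAdelic F E c 2) (hne : ψ (β₀ * w) ≠ 0)
    {β : (quasiSplit F E c 2).Adelic} (hβ : β ∈ borelAdelic F E c 2) {k : (quasiSplit F E c 2).Adelic} (hk : k ∈ K') (h : β * w = w * k) :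
    ((χ (firstEntryUnit hβ) : ℂˣ) : ℂ) = 1 := by
  have hβ'' : β₀ * β * β₀⁻¹ ∈ borelAdelic F E c 2 := (borelAdelic F E c 2).mul_mem ((borelAdelic F E c 2).mul_mem hβ₀ hβ) ((borelAdelic F E c 2).inv_mem hβ₀)
  have hN : IdeleClassGroup.ideleNorm E (firstEntryUnit hβ'') = 1 := by
    rw [firstEntryUnit_conj hβ₀ hβ]; exact ideleNorm_firstEntryUnit_eq_one_of_mul_eq hHK' hβ hk h
  have h1 : ψ (β₀ * β * w) = ψ (β₀ * w) := by rw [mul_assoc, h, ← mul_assoc, hψK _ _ hk]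
  have h2 : ψ (β₀ * β * w) = ((χ (firstEntryUnit hβ) : ℂˣ) : ℂ) * ψ (β₀ * w) := by
    have h3 := hψχ _ hβ'' hN (β₀ * w)
    rw [firstEntryUnit_conj hβ₀ hβ] at h3
    rw [← h3]; congr 1; group
  rw [h1] at h2
  exact ((mul_eq_right₀ hne).1 h2.symm)

/-- **WELL-DEFINEDNESS**: under the same hypotheses, `β w k = β' w k'` (`β, β' ∈ B(𝔸)`, `k, k' ∈ K′`) forces `χ(β₀₀) = χ(β'₀₀)`. [cite: MoeglinWaldspurger1995, I.2.17] -/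
theorem chi_firstEntryUnit_eq_of_eq {K' : Subgroup (quasiSplit F E c 2).Adelic}
    (hHK' : ∀ (g k : (quasiSplit F E c 2).Adelic), k ∈ K' → borelHeight (g * k) = borelHeight g) (χ : HeckeCharacter E)
    {ψ : (quasiSplit F E c 2).Adelic → ℂ} (hψK : ∀ (g k : (quasiSplit F E c 2).Adelic), k ∈ K' → ψ (g * k) = ψ g)
    (hψχ : ∀ (b : (quasiSplit F E c 2).Adelic) (hb : b ∈ borelAdelic F E c 2), IdeleClassGroup.ideleNorm E (firstEntryUnit hb) = 1 →
      ∀ g, ψ (b * g) = ((χ (firstEntryUnit hb) : ℂˣ) : ℂ) * ψ g)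
    {w β₀ : (quasiSplit F E c 2).Adelic} (hβ₀ : β₀ ∈ borelAdelic F E c 2) (hne : ψ (β₀ * w) ≠ 0)
    {β β' k k' : (quasiSplit F E c 2).Adelic} (hβ : β ∈ borelAdelic F E c 2) (hβ' : β' ∈ borelAdelic F E c 2) (hk : k ∈ K') (hk' : k' ∈ K')
    (h : β * w * k = β' * w * k') :
    ((χ (firstEntryUnit hβ) : ℂˣ) : ℂ) = ((χ (firstEntryUnit hβ') : ℂˣ) : ℂ) := by
  have hq : β⁻¹ * β' * w = w * (k * k'⁻¹) := by
    calc β⁻¹ * β' * w = β⁻¹ * (β' * w * k') * k'⁻¹ := by group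
      _ = β⁻¹ * (β * w * k) * k'⁻¹ := by rw [h]
      _ = w * (k * k'⁻¹) := by group
  have h1 := chi_firstEntryUnit_eq_one_of_apply_ne_zero hHK' χ hψK hψχ hβ₀ hne ((borelAdelic F E c 2).mul_mem ((borelAdelic F E c 2).inv_mem hβ) hβ')
    (K'.mul_mem hk (K'.inv_mem hk')) hq
  rw [firstEntryUnit_inv_mul hβ hβ', map_mul, map_inv, Units.val_mul, Units.val_inv_eq_inv_val, inv_mul_eq_one₀ (Units.ne_zero _)] at h1
  exact h1

/-- `d₀(β⁻¹) = (d₀ β)⁻¹`. [cite: Rogawski1990, §1.10] -/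
theorem firstEntryUnit_inv {β : (quasiSplit F E c 2).Adelic} (hβ : β ∈ borelAdelic F E c 2) :
    firstEntryUnit ((borelAdelic F E c 2).inv_mem hβ) = (firstEntryUnit hβ)⁻¹ := by
  rw [firstEntryUnit_eq_diagUnit_zero, firstEntryUnit_eq_diagUnit_zero]
  exact diagUnit_inv_apply (⟨β, hβ⟩ : borelAdelic F E c 2) 0

/-! ## §2 One double coset: `ψ|_{B(𝔸) w K′} = f_w(H)·φ_w` -/

/-- **ONE DOUBLE COSET**: on `d = B(𝔸) w K′` a continuous, right-`K′`-invariant, norm-one-Borel `χ`-isotypic `ψ` supported in a height band is `f(H)·φ` with `f ∈ C_c((0,∞))` continuous and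
`φ ∈ chiSectionSpace χ K′ 1` continuous and vanishing off `d` (construction (i)–(iii) of the module docstring; ★ `exists_torusRay_two`).
[cite: MoeglinWaldspurger1995, I.2.17, II.1.1] [cite: GelbartJacquet1979Corvallis, §3] -/
theorem exists_pureTensor_on_doubleCoset (hc : c * c = 1) {K' : Subgroup (quasiSplit F E c 2).Adelic} (hK'o : IsOpen (K' : Set (quasiSplit F E c 2).Adelic))
    (hHK' : ∀ (g k : (quasiSplit F E c 2).Adelic), k ∈ K' → borelHeight (g * k) = borelHeight g)
    (χ : HeckeCharacter E) (hχray : ∀ r : ℝ≥0ˣ, χ (posRealIdele E r) = 1)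
    {ψ : (quasiSplit F E c 2).Adelic → ℂ} (hψc : Continuous ψ) (hψK : ∀ (g k : (quasiSplit F E c 2).Adelic), k ∈ K' → ψ (g * k) = ψ g)
    (hψχ : ∀ (b : (quasiSplit F E c 2).Adelic) (hb : b ∈ borelAdelic F E c 2), IdeleClassGroup.ideleNorm E (firstEntryUnit hb) = 1 →
      ∀ g, ψ (b * g) = ((χ (firstEntryUnit hb) : ℂˣ) : ℂ) * ψ g)
    {a b : ℝ≥0} (ha : 0 < a) (hband : ∀ g, ψ g ≠ 0 → a ≤ borelHeight g ∧ borelHeight g ≤ b) (w : (quasiSplit F E c 2).Adelic) :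
    ∃ (f : ℝ → ℂ) (φ : (quasiSplit F E c 2).Adelic → ℂ), Continuous f ∧ HasCompactSupport f ∧ tsupport f ⊆ Ioi 0 ∧ φ ∈ chiSectionSpace χ K' 1 ∧ Continuous φ ∧
      (∀ g, g ∉ DoubleCoset.doubleCoset w (borelAdelic F E c 2 : Set (quasiSplit F E c 2).Adelic) K' → φ g = 0) ∧
      ∀ g ∈ DoubleCoset.doubleCoset w (borelAdelic F E c 2 : Set (quasiSplit F E c 2).Adelic) K', ψ g = f (borelHeight g) * φ g := by
  classical
  by_cases hvan : ∀ g ∈ DoubleCoset.doubleCoset w (borelAdelic F E c 2 : Set (quasiSplit F E c 2).Adelic) K', ψ g = 0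
  · refine ⟨0, 0, continuous_const, HasCompactSupport.of_support_subset_isCompact isCompact_empty (by simp), by simp [tsupport], Submodule.zero_mem _,
      continuous_const, fun _ _ => rfl, fun g hg => by simp [hvan g hg]⟩
  simp only [not_forall, exists_prop] at hvan
  obtain ⟨g₀, hg₀, hψg₀⟩ := hvan
  obtain ⟨β₀, hβ₀, k₀, hk₀, hg₀eq⟩ := DoubleCoset.mem_doubleCoset.1 hg₀
  have hne : ψ (β₀ * w) ≠ 0 := by rwa [hg₀eq, hψK _ _ hk₀] at hψg₀
  -- the diagonal ray
  obtain ⟨ρ, hρc, -, hρd, -⟩ := exists_torusRay_two (F := F) (E := E) (c := c) hc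
  set D : ℝ := (Module.finrank ℚ E : ℝ) with hD
  have hDpos : 0 < D := by rw [hD]; exact_mod_cast Module.finrank_pos
  have hρB : ∀ s, (((ρ s : torusInBorel F E c 2) : borelAdelic F E c 2) : (quasiSplit F E c 2).Adelic) ∈ borelAdelic F E c 2 := fun s => ((ρ s : torusInBorel F E c 2) : borelAdelic F E c 2).2
  have hρfe : ∀ s, firstEntryUnit (hρB s) = posRealIdele E (expUnitNNReal s) := fun s => by rw [firstEntryUnit_eq_diagUnit_zero]; exact hρd s
  have hρN : ∀ s, IdeleClassGroup.ideleNorm E (firstEntryUnit (hρB s)) = ((expUnitNNReal (Module.finrank ℚ E * s) : ℝ≥0ˣ) : ℝ≥0) := fun s => by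
    rw [hρfe, UnitaryGroup.ideleNorm_posRealIdele_expUnitNNReal]
  have hχρ : ∀ s, ((χ (firstEntryUnit (hρB s)) : ℂˣ) : ℂ) = 1 := fun s => by rw [hρfe, hχray, Units.val_one]
  have hHρ : ∀ (s : ℝ) (g : (quasiSplit F E c 2).Adelic), (borelHeight ((((ρ s : torusInBorel F E c 2) : borelAdelic F E c 2) : (quasiSplit F E c 2).Adelic) * g) : ℝ) =
      Real.exp (D * s) * borelHeight g := fun s g => by
    rw [borelHeight_borel_mul_eq_ideleNorm_firstEntryUnit_mul (hρB s), hρN s, NNReal.coe_mul]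
    rfl
  -- the functions
  set f : ℝ → ℂ := fun h => if 0 < h then ψ ((((ρ (Real.log (h / borelHeight w) / D) : torusInBorel F E c 2) : borelAdelic F E c 2) : (quasiSplit F E c 2).Adelic) * w) else 0 with hf
  set φ : (quasiSplit F E c 2).Adelic → ℂ := fun g =>
    if hg : g ∈ DoubleCoset.doubleCoset w (borelAdelic F E c 2 : Set (quasiSplit F E c 2).Adelic) K' then ((χ (firstEntryUnit (DoubleCoset.mem_doubleCoset.1 hg).choose_spec.1) : ℂˣ) : ℂ) else 0 with hφ
  -- evaluation of `φ` on any representation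
  have hφev : ∀ (β : (quasiSplit F E c 2).Adelic) (hβ : β ∈ borelAdelic F E c 2) (k : (quasiSplit F E c 2).Adelic), k ∈ K' →
      φ (β * w * k) = ((χ (firstEntryUnit hβ) : ℂˣ) : ℂ) := fun β hβ k hk => by
    have hg : β * w * k ∈ DoubleCoset.doubleCoset w (borelAdelic F E c 2 : Set (quasiSplit F E c 2).Adelic) K' := DoubleCoset.mem_doubleCoset.2 ⟨β, hβ, k, hk, rfl⟩
    simp only [hφ, dif_pos hg]
    have hspec := (DoubleCoset.mem_doubleCoset.1 hg).choose_spec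
    obtain ⟨y, hy, hyeq⟩ := hspec.2
    exact (chi_firstEntryUnit_eq_of_eq hHK' χ hψK hψχ hβ₀ hne hβ hspec.1 hk hy hyeq).symm
  have hφK : ∀ (g k : (quasiSplit F E c 2).Adelic), k ∈ K' → φ (g * k) = φ g := fun g k hk => by
    by_cases hg : g ∈ DoubleCoset.doubleCoset w (borelAdelic F E c 2 : Set (quasiSplit F E c 2).Adelic) K'
    · obtain ⟨β, hβ, k', hk', rfl⟩ := DoubleCoset.mem_doubleCoset.1 hg
      rw [mul_assoc (β * w), hφev β hβ _ (K'.mul_mem hk' hk), hφev β hβ _ hk']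
    · have hgk : g * k ∉ DoubleCoset.doubleCoset w (borelAdelic F E c 2 : Set (quasiSplit F E c 2).Adelic) K' := fun hmem => hg (by
        obtain ⟨x, hx, y, hy, hxy⟩ := DoubleCoset.mem_doubleCoset.1 hmem
        exact DoubleCoset.mem_doubleCoset.2 ⟨x, hx, y * k⁻¹, K'.mul_mem hy (K'.inv_mem hk), by rw [← mul_assoc, ← hxy, mul_inv_cancel_right]⟩)
      simp only [hφ, dif_neg hg, dif_neg hgk]
  have hφoff : ∀ g, g ∉ DoubleCoset.doubleCoset w (borelAdelic F E c 2 : Set (quasiSplit F E c 2).Adelic) K' → φ g = 0 := fun g hg => by simp only [hφ, dif_neg hg]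
  -- the height of `ρ(s_h) w` is `h`
  have hHw : ∀ h : ℝ, 0 < h → (borelHeight ((((ρ (Real.log (h / borelHeight w) / D) : torusInBorel F E c 2) : borelAdelic F E c 2) : (quasiSplit F E c 2).Adelic) * w) : ℝ) = h :=
    fun h hh => by
    have hw : (0 : ℝ) < borelHeight w := borelHeight_pos w
    rw [hHρ, mul_div_cancel₀ _ hDpos.ne', Real.exp_log (div_pos hh hw), div_mul_cancel₀ _ hw.ne']
  -- `f` vanishes below `a` and above `b`
  have hfzero : ∀ h : ℝ, (h < a ∨ (b : ℝ) < h) → f h = 0 := fun h hh => by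
    simp only [hf]
    split_ifs with hpos
    · by_contra hψ
      have hb := hband _ hψ
      have hH := hHw h hpos
      rcases hh with hlt | hgt
      · have h1 : ((a : ℝ≥0) : ℝ) ≤ h := by rw [← hH]; exact_mod_cast hb.1
        exact absurd hlt (not_lt.2 h1)
      · have h1 : h ≤ ((b : ℝ≥0) : ℝ) := by rw [← hH]; exact_mod_cast hb.2
        exact absurd hgt (not_lt.2 h1)
    · rfl
  have hfc : Continuous f := by
    refine continuous_iff_continuousAt.2 fun h₀ => ?_
    by_cases h₀pos : 0 < h₀
    · have hF : ContinuousAt (fun h : ℝ => ψ ((((ρ (Real.log (h / borelHeight w) / D) : torusInBorel F E c 2) : borelAdelic F E c 2) : (quasiSplit F E c 2).Adelic) * w)) h₀ := by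
        have hw : (0 : ℝ) < borelHeight w := borelHeight_pos w
        have h1 : ContinuousAt (fun h : ℝ => h / (borelHeight w : ℝ)) h₀ := continuousAt_id.div_const _
        have h2 : ContinuousAt Real.log ((fun h : ℝ => h / (borelHeight w : ℝ)) h₀) := Real.continuousAt_log (div_pos h₀pos hw).ne'
        have hlog : ContinuousAt (fun h : ℝ => Real.log (h / borelHeight w) / D) h₀ := by
          have h3 := (ContinuousAt.comp (f := fun h : ℝ => h / (borelHeight w : ℝ)) (g := Real.log) h2 h1).div_const D
          simpa only [Function.comp_def] using h3
        exact (hψc.continuousAt).comp ((((continuous_subtype_val.comp continuous_subtype_val).comp hρc).continuousAt.comp hlog).mul continuousAt_const)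
      refine hF.congr (Filter.eventuallyEq_of_mem (Ioi_mem_nhds h₀pos) fun h hh => ?_)
      simp only [hf, if_pos (show 0 < h from hh)]
    · refine (continuousAt_const (y := (0 : ℂ))).congr (Filter.eventuallyEq_of_mem (Iio_mem_nhds (show h₀ < (a : ℝ) from (not_lt.1 h₀pos).trans_lt (by exact_mod_cast ha))) ?_)
      intro h hh
      exact (hfzero h (Or.inl hh)).symm
  have hfsupp : Function.support f ⊆ Icc (a : ℝ) b := fun h hh => by
    by_contra hI
    rw [mem_Icc, not_and_or, not_le, not_le] at hI
    exact hh (hfzero h hI)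
  refine ⟨f, φ, hfc, HasCompactSupport.of_support_subset_isCompact isCompact_Icc hfsupp,
    (closure_minimal hfsupp isClosed_Icc).trans fun h hh => lt_of_lt_of_le (by exact_mod_cast ha) hh.1, ?_, continuous_of_mul_mem_isOpen hK'o hφK, hφoff, ?_⟩
  · -- `φ ∈ chiSectionSpace χ K′ 1`
    refine (mem_chiSectionSpace_iff φ).2 ⟨fun b' hb' g => ?_, fun g k => by rw [hφK g k k.2, Pi.one_apply, one_mul]⟩
    by_cases hg : g ∈ DoubleCoset.doubleCoset w (borelAdelic F E c 2 : Set (quasiSplit F E c 2).Adelic) K'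
    · obtain ⟨β, hβ, k, hk, rfl⟩ := DoubleCoset.mem_doubleCoset.1 hg
      rw [show b' * (β * w * k) = b' * β * w * k by simp only [mul_assoc], hφev _ ((borelAdelic F E c 2).mul_mem hb' hβ) k hk, hφev β hβ k hk,
        firstEntryUnit_mul hb' hβ, map_mul, Units.val_mul]
    · have hbg : b' * g ∉ DoubleCoset.doubleCoset w (borelAdelic F E c 2 : Set (quasiSplit F E c 2).Adelic) K' := fun hmem => hg (by
        obtain ⟨x, hx, y, hy, hxy⟩ := DoubleCoset.mem_doubleCoset.1 hmem
        exact DoubleCoset.mem_doubleCoset.2 ⟨b'⁻¹ * x, (borelAdelic F E c 2).mul_mem ((borelAdelic F E c 2).inv_mem hb') hx, y, hy, by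
          rw [mul_assoc b'⁻¹, mul_assoc b'⁻¹, ← hxy, inv_mul_cancel_left]⟩)
      rw [hφoff _ hg, hφoff _ hbg, mul_zero]
  · -- the identity on the double coset
    intro g hg
    obtain ⟨β, hβ, k, hk, rfl⟩ := DoubleCoset.mem_doubleCoset.1 hg
    rw [hφev β hβ k hk, hψK _ _ hk, hHK' _ _ hk]
    -- `β = β₁ ρ(s)`, `e^{Ds} = ‖β₀₀‖`
    set nβ : ℝ≥0 := IdeleClassGroup.ideleNorm E (firstEntryUnit hβ) with hnβ
    have hnβpos : (0 : ℝ) < nβ := by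
      have h := borelHeight_borel_mul_eq_ideleNorm_firstEntryUnit_mul hβ w
      have h1 : nβ * borelHeight w ≠ 0 := by rw [hnβ, ← h]; exact (borelHeight_pos _).ne'
      have h2 : nβ ≠ 0 := left_ne_zero_of_mul h1
      exact_mod_cast pos_iff_ne_zero.2 h2
    set s : ℝ := Real.log nβ / D with hs
    have hexp : Real.exp (D * s) = nβ := by rw [hs, mul_div_cancel₀ _ hDpos.ne', Real.exp_log hnβpos]
    have hexpU : ((expUnitNNReal (Module.finrank ℚ E * s) : ℝ≥0ˣ) : ℝ≥0) = nβ := NNReal.eq hexp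
    -- `β₁ := β ρ(s)⁻¹` is norm-one
    have hβ₁ : β * ((((ρ s : torusInBorel F E c 2) : borelAdelic F E c 2) : (quasiSplit F E c 2).Adelic))⁻¹ ∈ borelAdelic F E c 2 :=
      (borelAdelic F E c 2).mul_mem hβ ((borelAdelic F E c 2).inv_mem (hρB s))
    have hfe₁ : firstEntryUnit hβ₁ = firstEntryUnit hβ * (firstEntryUnit (hρB s))⁻¹ := by
      rw [show firstEntryUnit hβ₁ = firstEntryUnit ((borelAdelic F E c 2).mul_mem hβ ((borelAdelic F E c 2).inv_mem (hρB s))) from rfl,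
        firstEntryUnit_mul hβ ((borelAdelic F E c 2).inv_mem (hρB s)), firstEntryUnit_inv (hρB s)]
    have hN₁ : IdeleClassGroup.ideleNorm E (firstEntryUnit hβ₁) = 1 := by
      rw [hfe₁, map_mul, map_inv, hρN s, hexpU, ← hnβ, mul_inv_cancel₀ (ne_of_gt (by exact_mod_cast hnβpos))]
    have hχ₁ : ((χ (firstEntryUnit hβ₁) : ℂˣ) : ℂ) = ((χ (firstEntryUnit hβ) : ℂˣ) : ℂ) := by
      rw [hfe₁, map_mul, map_inv, Units.val_mul, Units.val_inv_eq_inv_val, hχρ s, inv_one, mul_one]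
    -- `ψ(β w) = χ(β₀₀) ψ(ρ(s) w)`
    have hψβ : ψ (β * w) = ((χ (firstEntryUnit hβ) : ℂˣ) : ℂ) * ψ ((((ρ s : torusInBorel F E c 2) : borelAdelic F E c 2) : (quasiSplit F E c 2).Adelic) * w) := by
      have h1 := hψχ _ hβ₁ hN₁ ((((ρ s : torusInBorel F E c 2) : borelAdelic F E c 2) : (quasiSplit F E c 2).Adelic) * w)
      rw [hχ₁, ← mul_assoc, inv_mul_cancel_right] at h1
      exact h1
    -- `f(H(βw)) = ψ(ρ(s) w)`
    have hHβw : ((borelHeight (β * w) : ℝ≥0) : ℝ) = nβ * borelHeight w := by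
      rw [borelHeight_borel_mul_eq_ideleNorm_firstEntryUnit_mul hβ w, NNReal.coe_mul]
    have hpos : (0 : ℝ) < borelHeight (β * w) := borelHeight_pos _
    have hfval : f (borelHeight (β * w)) = ψ ((((ρ s : torusInBorel F E c 2) : borelAdelic F E c 2) : (quasiSplit F E c 2).Adelic) * w) := by
      simp only [hf, if_pos hpos]
      have hw : (borelHeight w : ℝ) ≠ 0 := NNReal.coe_ne_zero.2 (borelHeight_pos w).ne'
      rw [hHβw, mul_div_cancel_right₀ _ hw]
    rw [hfval, hψβ, mul_comm]

/-! ## §3 The decomposition -/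

/-- **THE PURE-TENSOR DECOMPOSITION**: with finitely many `(B(𝔸), K′)`-double cosets (`hBK`), a continuous right-`K′`-invariant norm-one-Borel `χ`-isotypic `ψ` supported in a height band is a
FINITE SUM `ψ(g) = Σ_i f_i(H(g))·φ_i(g)` with `f_i` continuous, compactly supported in `(0,∞)`, and `φ_i ∈ chiSectionSpace χ K′ 1` continuous — the generators of ★ W-b ∕ H-χ ∕ C9.
[cite: MoeglinWaldspurger1995, I.2.17, II.1.1] [cite: GelbartJacquet1979Corvallis, §3] -/
theorem exists_sum_pureTensor_eq (hc : c * c = 1) {K' : Subgroup (quasiSplit F E c 2).Adelic} (hK'o : IsOpen (K' : Set (quasiSplit F E c 2).Adelic))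
    (hHK' : ∀ (g k : (quasiSplit F E c 2).Adelic), k ∈ K' → borelHeight (g * k) = borelHeight g)
    (hBK : ∃ W : Finset (quasiSplit F E c 2).Adelic, ∀ g : (quasiSplit F E c 2).Adelic, ∃ β ∈ borelAdelic F E c 2, ∃ w ∈ W, ∃ k ∈ K', g = β * w * k)
    (χ : HeckeCharacter E) (hχray : ∀ r : ℝ≥0ˣ, χ (posRealIdele E r) = 1)
    {ψ : (quasiSplit F E c 2).Adelic → ℂ} (hψc : Continuous ψ) (hψK : ∀ (g k : (quasiSplit F E c 2).Adelic), k ∈ K' → ψ (g * k) = ψ g)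
    (hψχ : ∀ (b : (quasiSplit F E c 2).Adelic) (hb : b ∈ borelAdelic F E c 2), IdeleClassGroup.ideleNorm E (firstEntryUnit hb) = 1 →
      ∀ g, ψ (b * g) = ((χ (firstEntryUnit hb) : ℂˣ) : ℂ) * ψ g)
    {a b : ℝ≥0} (ha : 0 < a) (hband : ∀ g, ψ g ≠ 0 → a ≤ borelHeight g ∧ borelHeight g ≤ b) :
    ∃ (ι : Type) (_ : Fintype ι) (f : ι → ℝ → ℂ) (φ : ι → (quasiSplit F E c 2).Adelic → ℂ),
      (∀ i, Continuous (f i) ∧ HasCompactSupport (f i) ∧ tsupport (f i) ⊆ Ioi 0 ∧ φ i ∈ chiSectionSpace χ K' 1 ∧ Continuous (φ i)) ∧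
      ∀ g, ψ g = ∑ i, f i (borelHeight g) * φ i g := by
  classical
  obtain ⟨W, hW⟩ := hBK
  set Q : Finset (DoubleCoset.Quotient (borelAdelic F E c 2 : Set (quasiSplit F E c 2).Adelic) (K' : Set (quasiSplit F E c 2).Adelic)) :=
    W.image (fun w => DoubleCoset.mk (borelAdelic F E c 2) K' w) with hQ
  -- one pure tensor per double coset (representative `q.out`)
  have hD := fun q : ↥Q => exists_pureTensor_on_doubleCoset hc hK'o hHK' χ hχray hψc hψK hψχ ha hband (q.1.out : (quasiSplit F E c 2).Adelic)
  choose f φ hf hfs hf0 hφV hφc hφoff hψeq using hD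
  refine ⟨↥Q, inferInstance, f, φ, fun q => ⟨hf q, hfs q, hf0 q, hφV q, hφc q⟩, fun g => ?_⟩
  -- the class of `g`
  obtain ⟨β, hβ, w, hw, k, hk, hgeq⟩ := hW g
  have hgq : DoubleCoset.mk (borelAdelic F E c 2) K' g ∈ Q := by
    rw [hQ, Finset.mem_image]
    exact ⟨w, hw, (DoubleCoset.eq _ _ w g).2 ⟨β, hβ, k, hk, hgeq⟩⟩
  set q₀ : ↥Q := ⟨DoubleCoset.mk (borelAdelic F E c 2) K' g, hgq⟩ with hq₀
  -- `g` lies in the double coset of `q₀.out` and in no other `q.out`-coset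
  have hmem : ∀ q : ↥Q, g ∈ DoubleCoset.doubleCoset (q.1.out : (quasiSplit F E c 2).Adelic) (borelAdelic F E c 2 : Set (quasiSplit F E c 2).Adelic) K' ↔ q = q₀ := fun q => by
    rw [DoubleCoset.mem_doubleCoset]
    constructor
    · rintro ⟨x, hx, y, hy, hxy⟩
      apply Subtype.ext
      rw [hq₀]
      show q.1 = DoubleCoset.mk (borelAdelic F E c 2) K' g
      rw [← DoubleCoset.out_eq' _ _ q.1]
      exact (DoubleCoset.eq _ _ _ g).2 ⟨x, hx, y, hy, hxy⟩
    · rintro rfl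
      have h := (DoubleCoset.eq (borelAdelic F E c 2) K' (q₀.1.out) g).1 (by rw [DoubleCoset.out_eq']) 
      obtain ⟨x, hx, y, hy, hxy⟩ := h
      exact ⟨x, hx, y, hy, hxy⟩
  rw [Finset.sum_eq_single q₀ (fun q _ hq => by rw [hφoff q g (fun hm => hq ((hmem q).1 hm)), mul_zero]) (fun hq => absurd (Finset.mem_univ q₀) hq)]
  exact hψeq q₀ g ((hmem q₀).2 rfl)

/-- **THE PURE-TENSOR DECOMPOSITION, WITH TERMWISE DOMINATION**: as `exists_sum_pureTensor_eq`, and moreover every term is dominated by `ψ` itself, `|f_i(H(g)) φ_i(g)| ≤ |ψ(g)|` (each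
term is `ψ` on its own double coset and `0` elsewhere) — so each pure tensor inherits boundedness and the height band from `ψ` (the `hv` ∕ band binders of the C7 HEAD and of ★ F3d-γ).
[cite: MoeglinWaldspurger1995, I.2.17, II.1.1] -/
theorem exists_sum_pureTensor_eq_norm_le (hc : c * c = 1) {K' : Subgroup (quasiSplit F E c 2).Adelic} (hK'o : IsOpen (K' : Set (quasiSplit F E c 2).Adelic))
    (hHK' : ∀ (g k : (quasiSplit F E c 2).Adelic), k ∈ K' → borelHeight (g * k) = borelHeight g)
    (hBK : ∃ W : Finset (quasiSplit F E c 2).Adelic, ∀ g : (quasiSplit F E c 2).Adelic, ∃ β ∈ borelAdelic F E c 2, ∃ w ∈ W, ∃ k ∈ K', g = β * w * k)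
    (χ : HeckeCharacter E) (hχray : ∀ r : ℝ≥0ˣ, χ (posRealIdele E r) = 1)
    {ψ : (quasiSplit F E c 2).Adelic → ℂ} (hψc : Continuous ψ) (hψK : ∀ (g k : (quasiSplit F E c 2).Adelic), k ∈ K' → ψ (g * k) = ψ g)
    (hψχ : ∀ (b : (quasiSplit F E c 2).Adelic) (hb : b ∈ borelAdelic F E c 2), IdeleClassGroup.ideleNorm E (firstEntryUnit hb) = 1 →
      ∀ g, ψ (b * g) = ((χ (firstEntryUnit hb) : ℂˣ) : ℂ) * ψ g)
    {a b : ℝ≥0} (ha : 0 < a) (hband : ∀ g, ψ g ≠ 0 → a ≤ borelHeight g ∧ borelHeight g ≤ b) :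
    ∃ (ι : Type) (_ : Fintype ι) (f : ι → ℝ → ℂ) (φ : ι → (quasiSplit F E c 2).Adelic → ℂ),
      (∀ i, Continuous (f i) ∧ HasCompactSupport (f i) ∧ tsupport (f i) ⊆ Ioi 0 ∧ φ i ∈ chiSectionSpace χ K' 1 ∧ Continuous (φ i) ∧
        ∀ g, ‖f i (borelHeight g) * φ i g‖ ≤ ‖ψ g‖) ∧
      ∀ g, ψ g = ∑ i, f i (borelHeight g) * φ i g := by
  classical
  obtain ⟨W, hW⟩ := hBK
  set Q : Finset (DoubleCoset.Quotient (borelAdelic F E c 2 : Set (quasiSplit F E c 2).Adelic) (K' : Set (quasiSplit F E c 2).Adelic)) :=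
    W.image (fun w => DoubleCoset.mk (borelAdelic F E c 2) K' w) with hQ
  have hD := fun q : ↥Q => exists_pureTensor_on_doubleCoset hc hK'o hHK' χ hχray hψc hψK hψχ ha hband (q.1.out : (quasiSplit F E c 2).Adelic)
  choose f φ hf hfs hf0 hφV hφc hφoff hψeq using hD
  refine ⟨↥Q, inferInstance, f, φ, fun q => ⟨hf q, hfs q, hf0 q, hφV q, hφc q, fun g => ?_⟩, fun g => ?_⟩
  · by_cases hg : g ∈ DoubleCoset.doubleCoset (q.1.out : (quasiSplit F E c 2).Adelic) (borelAdelic F E c 2 : Set (quasiSplit F E c 2).Adelic) K'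
    · rw [← hψeq q g hg]
    · rw [hφoff q g hg, mul_zero, norm_zero]; exact norm_nonneg _
  -- the class of `g`
  obtain ⟨β, hβ, w, hw, k, hk, hgeq⟩ := hW g
  have hgq : DoubleCoset.mk (borelAdelic F E c 2) K' g ∈ Q := by
    rw [hQ, Finset.mem_image]
    exact ⟨w, hw, (DoubleCoset.eq _ _ w g).2 ⟨β, hβ, k, hk, hgeq⟩⟩
  set q₀ : ↥Q := ⟨DoubleCoset.mk (borelAdelic F E c 2) K' g, hgq⟩ with hq₀
  have hmem : ∀ q : ↥Q, g ∈ DoubleCoset.doubleCoset (q.1.out : (quasiSplit F E c 2).Adelic) (borelAdelic F E c 2 : Set (quasiSplit F E c 2).Adelic) K' ↔ q = q₀ := fun q => by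
    rw [DoubleCoset.mem_doubleCoset]
    constructor
    · rintro ⟨x, hx, y, hy, hxy⟩
      apply Subtype.ext
      rw [hq₀]
      show q.1 = DoubleCoset.mk (borelAdelic F E c 2) K' g
      rw [← DoubleCoset.out_eq' _ _ q.1]
      exact (DoubleCoset.eq _ _ _ g).2 ⟨x, hx, y, hy, hxy⟩
    · rintro rfl
      have h := (DoubleCoset.eq (borelAdelic F E c 2) K' (q₀.1.out) g).1 (by rw [DoubleCoset.out_eq'])
      obtain ⟨x, hx, y, hy, hxy⟩ := h
      exact ⟨x, hx, y, hy, hxy⟩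
  rw [Finset.sum_eq_single q₀ (fun q _ hq => by rw [hφoff q g (fun hm => hq ((hmem q).1 hm)), mul_zero]) (fun hq => absurd (Finset.mem_univ q₀) hq)]
  exact hψeq q₀ g ((hmem q₀).2 rfl)

end Summit.HodgeConjecture.HodgeConjecture.Cruxes.H413.K2E1ChiIsotypicPureTensorDecompositionU2

end
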